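import Literature.Topology.FourManifolds.GompfTheorem43Proofs
import Literature.AlgebraicTopology.FundamentalGroup.RotationLoopEssential
import Mathlib.LinearAlgebra.CrossProduct
import Mathlib.Analysis.SpecialFunctions.Complex.Arg
import HarnessLib

/-!
# Framing paths confined to a cone: every straightening class has a planar representative

R. Gompf, *More Cappell–Shaneson spheres are standard*, Algebr. Geom. Topol. 10 (2010), §4 ¶3
(application of Theorem 2.1 to a Cappell–Shaneson matrix `A` and `B = Δᵏ A`): "Theorem 2.1
applies, since the isotopy corresponding to **each** straightening of `A` can be chosen to keep
`φ(α)` within the torus `T` of that theorem, satisfying the required hypotheses. (The isotopies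
will differ by a full twist in the normal bundle of the curve.)" On the tree's representatives a
straightening class of `M ∈ GL⁺(3, ℝ)` is a homotopy class (rel end points, in `PosDetMatrix 3`)
of smooth framing paths `γ : SmoothMatrixPath M` from `1` to `M` (`SmoothMatrixPath.toPath`,
`GompfTheorem43.lean`), and an isotopy of `T³` straightening the linear monodromy near `0` with
linear germs `γ(τ)` keeps the image of a coordinate circle in direction `u` inside the flat
coordinate torus spanned by `u` and `M u` exactly when **`γ(τ) u` stays in the plane
`span {u, M u}`**. This file proves the matrix-path statement behind Gompf's sentence:

* `Literature.Topology.FourManifolds.SmoothMatrixPath.IsConeNice u γ` — `γ(θ) u = a(θ) u + b(θ) M u`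
  with smooth `a, b ≥ 0`, `b` vanishing exactly on an initial segment and `a` exactly on a final
  segment of parameters (so the moving vector sweeps the closed convex cone from the ray of `u`
  to the ray of `M u`, monotonically in the sense that it never returns to a ray it has left);
* `Literature.Topology.FourManifolds.conePath M u` — an explicit cone-nice path from `1` to `M`
  (a quarter turn in the plane `span {u, M u}` composed with a path fixing `u`, written in the
  adapted basis `(u, M u, u × M u)`), for any `M` of positive determinant and `u` with
  `u × M u ≠ 0`;
* `Literature.Topology.FourManifolds.coneLoopPath M u` — the same preceded by a full turn about
  the axis `u`, cone-nice as well, and **not** homotopic to `conePath M u`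
  (`coneLoopPath_not_homotopic`: the full turn is the generator of `π₁(GL⁺(3, ℝ)) = ℤ/2`,
  `RotationLoopEssential.square_false`);
* `Literature.Topology.FourManifolds.SmoothMatrixPath.exists_isConeNice_homotopic` — **every
  framing path from `1` to `M` is homotopic rel end points to a cone-nice one** (the two classes
  are exhausted by the pigeonhole `quotient_eq_or_eq_of_card_eq_two` from
  `π₁(GL⁺(3, ℝ)) = ℤ/2`, `fundamentalGroup_posDetMatrix_three_holds`);
* the Cappell–Shaneson specialisations `exists_isConeNice_e₃` (`u = e₃`, any `B` in Gompf's
  standard form) and `exists_isConeNice_inv_e₁` (`u = B⁻¹ e₁`).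

Everything is proved; no named facts are introduced. Generic tools: `SmoothMatrixPath.ofFun`
(a smooth path of invertible `3 × 3` matrices, constant near the ends, is a `SmoothMatrixPath`,
the inverse path being smooth by the adjugate formula), `SmoothMatrixPath.conjGL`, the rotation
paths `rotZPath`, `rotXPath`, the full turn `rotXLoop`, and `SmoothMatrixPath.toPath_concat_loop`.

## References

* R. E. Gompf, *More Cappell–Shaneson spheres are standard*, Algebr. Geom. Topol. 10 (2010)
  1665–1681, §4 (Def. 4.1: straightenings; ¶3: each straightening keeps `φ(α)` in `T`).
  [GompfAGT2010]
* A. Hatcher, *Algebraic Topology* (2002), §3.D (`π₁(SO(3)) = ℤ/2`, generated by a full turn).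
  [HatcherAT2002]
-/

noncomputable section

open scoped Matrix Real unitInterval ContDiff
open Set Function Matrix
open Literature.AlgebraicTopology.FundamentalGroup (rotX rotY rotZ)

namespace Literature.Topology.FourManifolds

/-! ### A generic constructor for smooth `3 × 3` matrix paths -/

namespace SmoothMatrixPath

variable {M N : Matrix (Fin 3) (Fin 3) ℝ}

/-- The entries of the inverse of a smooth path of invertible `3 × 3` matrices are smooth (adjugate
formula; `contDiff_det_fin_three`, `contDiff_adjugate_fin_three_apply` of `GompfFramedSpheres.lean`). [folklore] -/
theorem contDiff_inv_apply' {f : ℝ → Matrix (Fin 3) (Fin 3) ℝ}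
    (hf : ∀ i j, ContDiff ℝ ∞ fun θ ↦ f θ i j) (hdet : ∀ θ, (f θ).det ≠ 0) (i j : Fin 3) :
    ContDiff ℝ ∞ fun θ ↦ (f θ)⁻¹ i j := by
  have h : (fun θ ↦ (f θ)⁻¹ i j) = fun θ ↦ ((f θ).det)⁻¹ * (f θ).adjugate i j := by
    funext θ
    rw [Matrix.inv_def, Ring.inverse_eq_inv, Matrix.smul_apply, smul_eq_mul]
  rw [h]
  exact ((contDiff_det_fin_three hf).inv hdet).mul (contDiff_adjugate_fin_three_apply hf i j)

/-- **A smooth path of invertible `3 × 3` matrices, constant `= 1` for `θ ≤ 0` and `= M` for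
`θ ≥ 1`, is a `SmoothMatrixPath M`** (the inverse path `θ ↦ (f θ)⁻¹` is smooth by the adjugate
formula). [folklore] -/
def ofFun (f : ℝ → Matrix (Fin 3) (Fin 3) ℝ) (hf : ∀ i j, ContDiff ℝ ∞ fun θ ↦ f θ i j)
    (hdet : ∀ θ, (f θ).det ≠ 0) (h0 : ∀ θ ≤ (0 : ℝ), f θ = 1)
    (h1 : ∀ θ, (1 : ℝ) ≤ θ → f θ = M) : SmoothMatrixPath M where
  toFun := f
  inv θ := (f θ)⁻¹
  contDiff_apply := hf
  contDiff_inv_apply := contDiff_inv_apply' hf hdet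
  mul_inv θ := Matrix.mul_nonsing_inv _ (isUnit_iff_ne_zero.2 (hdet θ))
  inv_mul θ := Matrix.nonsing_inv_mul _ (isUnit_iff_ne_zero.2 (hdet θ))
  eq_one := h0
  eq_self := h1

/-- Values of `ofFun`. [folklore] -/
@[simp] theorem ofFun_toFun (f : ℝ → Matrix (Fin 3) (Fin 3) ℝ) (hf hdet h0 h1) :
    (ofFun (M := M) f hf hdet h0 h1).toFun = f := rfl

/-- **Conjugating a path by a fixed invertible matrix**: `θ ↦ P γ(θ) P⁻¹`, a path from `1` to
`P M P⁻¹`. [folklore] -/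
def conjGL (P : Matrix (Fin 3) (Fin 3) ℝ) (hP : P.det ≠ 0) (γ : SmoothMatrixPath N) :
    SmoothMatrixPath (P * N * P⁻¹) where
  toFun θ := P * γ.toFun θ * P⁻¹
  inv θ := P * γ.inv θ * P⁻¹
  contDiff_apply := contDiff_mul_apply (contDiff_mul_apply (fun _ _ ↦ contDiff_const)
    γ.contDiff_apply) fun _ _ ↦ contDiff_const
  contDiff_inv_apply := contDiff_mul_apply (contDiff_mul_apply (fun _ _ ↦ contDiff_const)
    γ.contDiff_inv_apply) fun _ _ ↦ contDiff_const
  mul_inv θ := by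
    have h1 : P⁻¹ * P = 1 := Matrix.nonsing_inv_mul _ (isUnit_iff_ne_zero.2 hP)
    have h2 : P * P⁻¹ = 1 := Matrix.mul_nonsing_inv _ (isUnit_iff_ne_zero.2 hP)
    calc P * γ.toFun θ * P⁻¹ * (P * γ.inv θ * P⁻¹)
        = P * (γ.toFun θ * (P⁻¹ * P) * γ.inv θ) * P⁻¹ := by simp only [Matrix.mul_assoc]
      _ = 1 := by rw [h1, Matrix.mul_one, γ.mul_inv, Matrix.mul_one, h2]
  inv_mul θ := by
    have h1 : P⁻¹ * P = 1 := Matrix.nonsing_inv_mul _ (isUnit_iff_ne_zero.2 hP)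
    have h2 : P * P⁻¹ = 1 := Matrix.mul_nonsing_inv _ (isUnit_iff_ne_zero.2 hP)
    calc P * γ.inv θ * P⁻¹ * (P * γ.toFun θ * P⁻¹)
        = P * (γ.inv θ * (P⁻¹ * P) * γ.toFun θ) * P⁻¹ := by simp only [Matrix.mul_assoc]
      _ = 1 := by rw [h1, Matrix.mul_one, γ.inv_mul, Matrix.mul_one, h2]
  eq_one θ hθ := by
    rw [γ.eq_one θ hθ, Matrix.mul_one, Matrix.mul_nonsing_inv _ (isUnit_iff_ne_zero.2 hP)]
  eq_self θ hθ := by rw [γ.eq_self θ hθ]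

/-- Values of `conjGL`. [folklore] -/
@[simp] theorem conjGL_toFun (P : Matrix (Fin 3) (Fin 3) ℝ) (hP : P.det ≠ 0)
    (γ : SmoothMatrixPath N) (θ : ℝ) : (conjGL P hP γ).toFun θ = P * γ.toFun θ * P⁻¹ := rfl

end SmoothMatrixPath

/-! ### Rotation paths and the full turn -/

section Rotations

/-- Local abbreviation: Mathlib's smooth transition function `σ` (`= 0` on `(-∞, 0]`, `= 1` on
`[1, ∞)`, increasing in between). -/
local notation "ς" => Real.smoothTransition

/-- `det (rotZ c s) = c² + s²`. [folklore] -/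
theorem det_rotZ' (c s : ℝ) : (rotZ c s).det = c ^ 2 + s ^ 2 := by
  simp [rotZ, Matrix.det_fin_three]; ring

/-- `det (rotX c s) = c² + s²`. [folklore] -/
theorem det_rotX' (c s : ℝ) : (rotX c s).det = c ^ 2 + s ^ 2 := by
  simp [rotX, Matrix.det_fin_three]; ring

/-- `rotZ 1 0 = 1`. [folklore] -/
theorem rotZ_one_zero' : rotZ 1 0 = 1 := by
  ext i j; fin_cases i <;> fin_cases j <;> simp [rotZ]

/-- `rotX 1 0 = 1`. [folklore] -/
theorem rotX_one_zero' : rotX 1 0 = 1 := by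
  ext i j; fin_cases i <;> fin_cases j <;> simp [rotX]

/-- `rotZ c s * rotZ c (-s) = 1` for `c² + s² = 1`. [folklore] -/
theorem rotZ_mul_rotZ_neg {c s : ℝ} (h : c ^ 2 + s ^ 2 = 1) : rotZ c s * rotZ c (-s) = 1 := by
  ext i j
  fin_cases i <;> fin_cases j <;>
    simp [rotZ, Matrix.mul_apply, Fin.sum_univ_three] <;> nlinarith [h]

/-- `rotX c s * rotX c (-s) = 1` for `c² + s² = 1`. [folklore] -/
theorem rotX_mul_rotX_neg {c s : ℝ} (h : c ^ 2 + s ^ 2 = 1) : rotX c s * rotX c (-s) = 1 := by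
  ext i j
  fin_cases i <;> fin_cases j <;>
    simp [rotX, Matrix.mul_apply, Fin.sum_univ_three] <;> nlinarith [h]

/-- **The rotation path about the third axis** through the angle `ϑ`: `θ ↦ R_z(ϑ ς(θ))`. [folklore] -/
def rotZPath (ϑ : ℝ) : SmoothMatrixPath (rotZ (Real.cos ϑ) (Real.sin ϑ)) :=
  SmoothMatrixPath.ofFun (fun θ ↦ rotZ (Real.cos (ϑ * ς θ)) (Real.sin (ϑ * ς θ)))
    (by
      intro i j
      fin_cases i <;> fin_cases j <;> simp [rotZ] <;> fun_prop)
    (fun θ ↦ by rw [det_rotZ', Real.cos_sq_add_sin_sq]; exact one_ne_zero)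
    (fun θ hθ ↦ by rw [Real.smoothTransition.zero_of_nonpos hθ, mul_zero, Real.cos_zero,
      Real.sin_zero, rotZ_one_zero'])
    (fun θ hθ ↦ by rw [Real.smoothTransition.one_of_one_le hθ, mul_one])

/-- Values of `rotZPath`. [folklore] -/
@[simp] theorem rotZPath_toFun (ϑ θ : ℝ) :
    (rotZPath ϑ).toFun θ = rotZ (Real.cos (ϑ * ς θ)) (Real.sin (ϑ * ς θ)) := rfl

/-- **The rotation path about the first axis** through the angle `ϑ`: `θ ↦ R_x(ϑ ς(θ))`. [folklore] -/
def rotXPath (ϑ : ℝ) : SmoothMatrixPath (rotX (Real.cos ϑ) (Real.sin ϑ)) :=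
  SmoothMatrixPath.ofFun (fun θ ↦ rotX (Real.cos (ϑ * ς θ)) (Real.sin (ϑ * ς θ)))
    (by
      intro i j
      fin_cases i <;> fin_cases j <;> simp [rotX] <;> fun_prop)
    (fun θ ↦ by rw [det_rotX', Real.cos_sq_add_sin_sq]; exact one_ne_zero)
    (fun θ hθ ↦ by rw [Real.smoothTransition.zero_of_nonpos hθ, mul_zero, Real.cos_zero,
      Real.sin_zero, rotX_one_zero'])
    (fun θ hθ ↦ by rw [Real.smoothTransition.one_of_one_le hθ, mul_one])

/-- Values of `rotXPath`. [folklore] -/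
@[simp] theorem rotXPath_toFun (ϑ θ : ℝ) :
    (rotXPath ϑ).toFun θ = rotX (Real.cos (ϑ * ς θ)) (Real.sin (ϑ * ς θ)) := rfl

/-- **The full turn about the first axis**, `θ ↦ R_x(2π ς(θ))`, a smooth loop at `1`. [cite: HatcherAT2002, §3.D (π₁(SO(3)) = ℤ₂, generated by a full rotation)] -/
def rotXLoop : SmoothMatrixPath (1 : Matrix (Fin 3) (Fin 3) ℝ) :=
  (rotXPath (2 * π)).cast (by rw [Real.cos_two_pi, Real.sin_two_pi, rotX_one_zero'])

/-- Values of `rotXLoop`. [folklore] -/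
@[simp] theorem rotXLoop_toFun (θ : ℝ) :
    rotXLoop.toFun θ = rotX (Real.cos (2 * π * ς θ)) (Real.sin (2 * π * ς θ)) := rfl

/-- The full turn about the first axis fixes `e₁`. [folklore] -/
theorem rotX_mulVec_single_zero (c s : ℝ) :
    rotX c s *ᵥ Pi.single 0 1 = Pi.single 0 1 := by
  ext i; fin_cases i <;> simp [rotX, Matrix.mulVec, dotProduct, Fin.sum_univ_three]

/-- `R_z(c, s) e₁ = c e₁ + s e₂`. [folklore] -/
theorem rotZ_mulVec_single_zero (c s : ℝ) :
    rotZ c s *ᵥ Pi.single 0 1 = c • Pi.single 0 1 + s • Pi.single 1 1 := by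
  ext i; fin_cases i <;> simp [rotZ, Matrix.mulVec, dotProduct, Fin.sum_univ_three]

end Rotations

/-! ### Segments to upper triangular matrices with positive diagonal -/

section Segment

/-- Local abbreviation: Mathlib's smooth transition function `σ`. -/
local notation "ς" => Real.smoothTransition

/-- **The reparametrised segment from `1` to an upper triangular matrix with positive diagonal**:
`θ ↦ (1 - ς θ) 1 + ς θ U`, invertible throughout since it is upper triangular with diagonal
entries convex combinations of `1` and positive numbers. [folklore] -/
def upperSegPath (U : Matrix (Fin 3) (Fin 3) ℝ) (h10 : U 1 0 = 0) (h20 : U 2 0 = 0)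
    (h21 : U 2 1 = 0) (h00 : 0 < U 0 0) (h11 : 0 < U 1 1) (h22 : 0 < U 2 2) :
    SmoothMatrixPath U :=
  SmoothMatrixPath.ofFun (fun θ ↦ (1 - ς θ) • (1 : Matrix (Fin 3) (Fin 3) ℝ) + ς θ • U)
    (by
      intro i j
      fin_cases i <;> fin_cases j <;> simp <;> fun_prop)
    (by
      intro θ
      have hσ0 := Real.smoothTransition.nonneg θ
      have hσ1 := Real.smoothTransition.le_one θ
      have hd : ∀ x : ℝ, 0 < x → 0 < (1 - ς θ) + ς θ * x := fun x hx ↦ by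
        rcases hσ0.lt_or_eq with h | h
        · nlinarith
        · rw [← h]; norm_num
      rw [Matrix.det_fin_three]
      simp [h10, h20, h21]
      exact ⟨⟨(hd _ h00).ne', (hd _ h11).ne'⟩, (hd _ h22).ne'⟩)
    (fun θ hθ ↦ by simp [Real.smoothTransition.zero_of_nonpos hθ])
    (fun θ hθ ↦ by simp [Real.smoothTransition.one_of_one_le hθ])

/-- Values of `upperSegPath`. [folklore] -/
@[simp] theorem upperSegPath_toFun (U : Matrix (Fin 3) (Fin 3) ℝ) (h10 h20 h21 h00 h11 h22)
    (θ : ℝ) : (upperSegPath U h10 h20 h21 h00 h11 h22).toFun θ =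
      (1 - ς θ) • (1 : Matrix (Fin 3) (Fin 3) ℝ) + ς θ • U := rfl

/-- The segment fixes `e₁` throughout (its first column is `e₁`). [folklore] -/
theorem upperSegPath_mulVec_single_zero (U : Matrix (Fin 3) (Fin 3) ℝ) (h10 h20 h21 h00 h11 h22)
    (hU00 : U 0 0 = 1) (θ : ℝ) :
    (upperSegPath U h10 h20 h21 h00 h11 h22).toFun θ *ᵥ Pi.single 0 1 = Pi.single 0 1 := by
  rw [upperSegPath_toFun, Matrix.mulVec_single_one]
  ext i
  fin_cases i <;> simp [hU00, h10, h20]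

end Segment

/-! ### The adapted basis `(u, M u, u × M u)` and the conjugated matrix -/

section Cone

variable (M : Matrix (Fin 3) (Fin 3) ℝ) (u : Fin 3 → ℝ)

/-- The normal `n = u × M u` of the plane `span {u, M u}`. [folklore] -/
def coneNormal : Fin 3 → ℝ := u ⨯₃ (M *ᵥ u)

/-- **The adapted basis matrix `P = (u | M u | u × M u)`** (columns). [folklore] -/
def coneBasis : Matrix (Fin 3) (Fin 3) ℝ := (Matrix.of ![u, M *ᵥ u, coneNormal M u])ᵀ

/-- `det P = |u × M u|²`. [folklore] -/
theorem det_coneBasis : (coneBasis M u).det = coneNormal M u ⬝ᵥ coneNormal M u := by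
  rw [coneBasis, Matrix.det_transpose]
  change Matrix.det ![u, M *ᵥ u, coneNormal M u] = _
  rw [← triple_product_eq_det, triple_product_permutation, triple_product_permutation]
  rfl

/-- `P e₁ = u`. [folklore] -/
@[simp] theorem coneBasis_mulVec_single_zero : coneBasis M u *ᵥ Pi.single 0 1 = u := by
  ext i; simp [coneBasis, Matrix.mulVec, dotProduct, Fin.sum_univ_three]

/-- `P e₂ = M u`. [folklore] -/
@[simp] theorem coneBasis_mulVec_single_one : coneBasis M u *ᵥ Pi.single 1 1 = M *ᵥ u := by
  ext i; simp [coneBasis, Matrix.mulVec, dotProduct, Fin.sum_univ_three]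

variable {M u}

/-- For `u × M u ≠ 0` the adapted basis is positively oriented. [folklore] -/
theorem det_coneBasis_pos (hn : coneNormal M u ≠ 0) : 0 < (coneBasis M u).det := by
  rw [det_coneBasis]
  exact Literature.AlgebraicTopology.FundamentalGroup.RotLoop.dotProduct_self_pos hn

/-- For `u × M u ≠ 0` the adapted basis matrix is invertible. [folklore] -/
theorem det_coneBasis_ne_zero (hn : coneNormal M u ≠ 0) : (coneBasis M u).det ≠ 0 :=
  (det_coneBasis_pos hn).ne'

/-- `P⁻¹ P = 1`. [folklore] -/
theorem coneBasis_inv_mul (hn : coneNormal M u ≠ 0) : (coneBasis M u)⁻¹ * coneBasis M u = 1 :=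
  Matrix.nonsing_inv_mul _ (isUnit_iff_ne_zero.2 (det_coneBasis_ne_zero hn))

/-- `P P⁻¹ = 1`. [folklore] -/
theorem coneBasis_mul_inv (hn : coneNormal M u ≠ 0) : coneBasis M u * (coneBasis M u)⁻¹ = 1 :=
  Matrix.mul_nonsing_inv _ (isUnit_iff_ne_zero.2 (det_coneBasis_ne_zero hn))

/-- `P⁻¹ u = e₁`. [folklore] -/
theorem coneBasis_inv_mulVec (hn : coneNormal M u ≠ 0) :
    (coneBasis M u)⁻¹ *ᵥ u = Pi.single 0 1 := by
  have h := congrArg ((coneBasis M u)⁻¹ *ᵥ ·) (coneBasis_mulVec_single_zero M u)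
  simp only [Matrix.mulVec_mulVec, coneBasis_inv_mul hn, Matrix.one_mulVec] at h
  exact h.symm

/-- `P⁻¹ M u = e₂`. [folklore] -/
theorem coneBasis_inv_mulVec_mulVec (hn : coneNormal M u ≠ 0) :
    (coneBasis M u)⁻¹ *ᵥ (M *ᵥ u) = Pi.single 1 1 := by
  have h := congrArg ((coneBasis M u)⁻¹ *ᵥ ·) (coneBasis_mulVec_single_one M u)
  simp only [Matrix.mulVec_mulVec, coneBasis_inv_mul hn, Matrix.one_mulVec] at h
  rw [Matrix.mulVec_mulVec, ← h]

variable (M u)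

/-- **`M' = P⁻¹ M P`**, the matrix of `M` in the adapted basis; its first column is `e₂`. [folklore] -/
def conePrime : Matrix (Fin 3) (Fin 3) ℝ := (coneBasis M u)⁻¹ * M * coneBasis M u

/-- `K = R_z(π/2)⁻¹ M'`; its first column is `e₁`. [folklore] -/
def coneK : Matrix (Fin 3) (Fin 3) ℝ := rotZ 0 (-1) * conePrime M u

/-- The complex number `K₁₁ + i K₂₁` whose argument is the angle of the second rotation. [folklore] -/
def coneZ : ℂ := ⟨coneK M u 1 1, coneK M u 2 1⟩

/-- The angle `ϑ = arg (K₁₁ + i K₂₁)`. [folklore] -/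
def coneAngle : ℝ := Complex.arg (coneZ M u)

/-- `U = R_x(ϑ)⁻¹ K`, upper triangular with positive diagonal. [folklore] -/
def coneU : Matrix (Fin 3) (Fin 3) ℝ :=
  rotX (Real.cos (coneAngle M u)) (-Real.sin (coneAngle M u)) * coneK M u

variable {M u}

/-- `M' e₁ = e₂`. [folklore] -/
theorem conePrime_mulVec_single_zero (hn : coneNormal M u ≠ 0) :
    conePrime M u *ᵥ Pi.single 0 1 = Pi.single 1 1 := by
  rw [conePrime, ← Matrix.mulVec_mulVec, ← Matrix.mulVec_mulVec, coneBasis_mulVec_single_zero,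
    coneBasis_inv_mulVec_mulVec hn]

/-- The first column of `M'` is `e₂`. [folklore] -/
theorem conePrime_apply_zero (hn : coneNormal M u ≠ 0) (i : Fin 3) :
    conePrime M u i 0 = (Pi.single 1 1 : Fin 3 → ℝ) i := by
  have h := congrFun (conePrime_mulVec_single_zero hn) i
  rwa [Matrix.mulVec_single_one] at h

/-- `det M' = det M`. [folklore] -/
theorem det_conePrime (hn : coneNormal M u ≠ 0) : (conePrime M u).det = M.det := by
  rw [conePrime, Matrix.det_mul, Matrix.det_mul, mul_comm ((coneBasis M u)⁻¹.det), mul_assoc,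
    ← Matrix.det_mul, coneBasis_inv_mul hn, Matrix.det_one, mul_one]

/-- The first column of `K` is `e₁`. [folklore] -/
theorem coneK_apply_zero (hn : coneNormal M u ≠ 0) (i : Fin 3) :
    coneK M u i 0 = (Pi.single 0 1 : Fin 3 → ℝ) i := by
  have h0 := conePrime_apply_zero hn 0
  have h1 := conePrime_apply_zero hn 1
  have h2 := conePrime_apply_zero hn 2
  simp only [Pi.single_apply] at h0 h1 h2
  simp only [coneK, Matrix.mul_apply, Fin.sum_univ_three, rotZ]
  fin_cases i <;> simp [h0, h1, h2]

/-- `det K = det M`. [folklore] -/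
theorem det_coneK (hn : coneNormal M u ≠ 0) : (coneK M u).det = M.det := by
  rw [coneK, Matrix.det_mul, det_rotZ', det_conePrime hn]; norm_num

/-- `det K = K₁₁ K₂₂ - K₁₂ K₂₁` (expansion along the first column `e₁`). [folklore] -/
theorem det_coneK_eq (hn : coneNormal M u ≠ 0) :
    (coneK M u).det = coneK M u 1 1 * coneK M u 2 2 - coneK M u 1 2 * coneK M u 2 1 := by
  have h0 := coneK_apply_zero hn 0
  have h1 := coneK_apply_zero hn 1
  have h2 := coneK_apply_zero hn 2
  simp only [Pi.single_apply] at h0 h1 h2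
  rw [Matrix.det_fin_three, h0, h1, h2]
  simp

/-- For `det M > 0` the number `K₁₁ + i K₂₁` is nonzero. [folklore] -/
theorem coneZ_ne_zero (hn : coneNormal M u ≠ 0) (hM : 0 < M.det) : coneZ M u ≠ 0 := by
  intro h
  have h1 : coneK M u 1 1 = 0 := by simpa [coneZ] using congrArg Complex.re h
  have h2 : coneK M u 2 1 = 0 := by simpa [coneZ] using congrArg Complex.im h
  have := det_coneK_eq hn
  rw [det_coneK hn, h1, h2] at this
  linarith

/-- `|K₁₁ + i K₂₁| > 0`. [folklore] -/
theorem norm_coneZ_pos (hn : coneNormal M u ≠ 0) (hM : 0 < M.det) : 0 < ‖coneZ M u‖ :=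
  norm_pos_iff.2 (coneZ_ne_zero hn hM)

/-- `cos ϑ = K₁₁ / |z|`. [folklore] -/
theorem cos_coneAngle (hn : coneNormal M u ≠ 0) (hM : 0 < M.det) :
    Real.cos (coneAngle M u) = coneK M u 1 1 / ‖coneZ M u‖ := by
  rw [coneAngle, Complex.cos_arg (coneZ_ne_zero hn hM)]; rfl

/-- `sin ϑ = K₂₁ / |z|`. [folklore] -/
theorem sin_coneAngle : Real.sin (coneAngle M u) = coneK M u 2 1 / ‖coneZ M u‖ := by
  rw [coneAngle, Complex.sin_arg]; rfl

/-- `|z|² = K₁₁² + K₂₁²`. [folklore] -/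
theorem norm_coneZ_sq : ‖coneZ M u‖ ^ 2 = coneK M u 1 1 ^ 2 + coneK M u 2 1 ^ 2 := by
  rw [Complex.sq_norm, Complex.normSq_apply]; simp [coneZ]; ring

/-- **The entries of `U = R_x(ϑ)⁻¹ K`**: upper triangular with diagonal `(1, |z|, det M / |z|)`. [folklore] -/
theorem coneU_entries (hn : coneNormal M u ≠ 0) (hM : 0 < M.det) :
    coneU M u 0 0 = 1 ∧ coneU M u 1 0 = 0 ∧ coneU M u 2 0 = 0 ∧ coneU M u 2 1 = 0 ∧
      coneU M u 1 1 = ‖coneZ M u‖ ∧ coneU M u 2 2 = M.det / ‖coneZ M u‖ := by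
  have h0 := coneK_apply_zero hn 0
  have h1 := coneK_apply_zero hn 1
  have h2 := coneK_apply_zero hn 2
  simp only [Pi.single_apply] at h0 h1 h2
  simp only [if_true] at h0
  simp only [show (1 : Fin 3) ≠ 0 from by decide, show (2 : Fin 3) ≠ 0 from by decide,
    if_false] at h1 h2
  have hρ := norm_coneZ_pos hn hM
  have hρ' : ‖coneZ M u‖ ≠ 0 := hρ.ne'
  have hc := cos_coneAngle hn hM
  have hs := sin_coneAngle (M := M) (u := u)
  have hsq := norm_coneZ_sq (M := M) (u := u)
  have hdet := det_coneK_eq hn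
  rw [det_coneK hn] at hdet
  have e : ∀ i j, coneU M u i j = rotX (Real.cos (coneAngle M u)) (-Real.sin (coneAngle M u)) i 0 *
      coneK M u 0 j + rotX (Real.cos (coneAngle M u)) (-Real.sin (coneAngle M u)) i 1 *
      coneK M u 1 j + rotX (Real.cos (coneAngle M u)) (-Real.sin (coneAngle M u)) i 2 *
      coneK M u 2 j := fun i j ↦ by
    rw [coneU, Matrix.mul_apply, Fin.sum_univ_three]
  refine ⟨?_, ?_, ?_, ?_, ?_, ?_⟩
  · rw [e]; simp [rotX, h0, h1, h2]
  · rw [e]; simp [rotX, h1, h2]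
  · rw [e]; simp [rotX, h1, h2]
  · rw [e]; simp [rotX, hc, hs]; ring
  · rw [e]; simp [rotX, hc, hs]
    field_simp
    nlinarith [hsq]
  · rw [e]; simp [rotX, hc, hs, hdet]
    field_simp
    ring

end Cone

/-! ### Cone-nice paths; the two explicit representatives -/

namespace SmoothMatrixPath

/-- **Cone-nice framing paths.** `γ(θ) u = a(θ) u + b(θ) M u` with smooth `a, b ≥ 0`, where
`a = 1, b = 0` for `θ ≤ 0`, `a = 0, b = 1` for `θ ≥ 1`, the zero set of `a` is a final segment of
parameters and the zero set of `b` an initial one: the moving vector `γ(θ) u` sweeps the closed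
convex cone from the ray of `u` to the ray of `M u` inside the plane `span {u, M u}` and never
returns to a ray it has left. For a straightening of a linear monodromy of `T³` with germs
`γ(θ)` this is the condition that the image of the coordinate circle in direction `u` stays in the
coordinate torus spanned by `u, M u` and meets the circle in direction `M u` in an arc (Gompf 2010,
§4 ¶3: "the isotopy … can be chosen to keep `φ(α)` within the torus `T`"). [cite: GompfAGT2010, §4 ¶3 (each straightening keeps φ(α) within T)] -/
def IsConeNice {M : Matrix (Fin 3) (Fin 3) ℝ} (u : Fin 3 → ℝ) (γ : SmoothMatrixPath M) : Prop :=
  ∃ a b : ℝ → ℝ, ContDiff ℝ ∞ a ∧ ContDiff ℝ ∞ b ∧ (∀ θ, 0 ≤ a θ) ∧ (∀ θ, 0 ≤ b θ) ∧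
    (∀ θ, θ ≤ 0 → a θ = 1 ∧ b θ = 0) ∧ (∀ θ, 1 ≤ θ → a θ = 0 ∧ b θ = 1) ∧
    (∀ θ θ', θ ≤ θ' → a θ = 0 → a θ' = 0) ∧ (∀ θ θ', θ ≤ θ' → b θ' = 0 → b θ = 0) ∧
    ∀ θ, γ.toFun θ *ᵥ u = a θ • u + b θ • M *ᵥ u

end SmoothMatrixPath

section Paths

/-- Local abbreviation: Mathlib's smooth transition function `σ`. -/
local notation "ς" => Real.smoothTransition

variable {M : Matrix (Fin 3) (Fin 3) ℝ} {u : Fin 3 → ℝ}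

/-- `R_z(π/2) R_x(ϑ) U = M'` (both rotations undo themselves). [folklore] -/
theorem rotZ_mul_rotX_mul_coneU :
    rotZ (Real.cos (π / 2)) (Real.sin (π / 2)) *
      (rotX (Real.cos (coneAngle M u)) (Real.sin (coneAngle M u)) * coneU M u) = conePrime M u := by
  rw [coneU, ← Matrix.mul_assoc (rotX _ _), rotX_mul_rotX_neg (Real.cos_sq_add_sin_sq _),
    Matrix.one_mul, coneK, ← Matrix.mul_assoc, Real.cos_pi_div_two, Real.sin_pi_div_two]
  have h : rotZ 0 1 * rotZ 0 (-1) = 1 := rotZ_mul_rotZ_neg (by norm_num)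
  rw [h, Matrix.one_mul]

/-- `P M' P⁻¹ = M`. [folklore] -/
theorem coneBasis_mul_conePrime_mul_inv (hn : coneNormal M u ≠ 0) :
    coneBasis M u * conePrime M u * (coneBasis M u)⁻¹ = M := by
  rw [conePrime, ← Matrix.mul_assoc, ← Matrix.mul_assoc, coneBasis_mul_inv hn, Matrix.one_mul,
    Matrix.mul_assoc, coneBasis_mul_inv hn, Matrix.mul_one]

/-- **The explicit path from `1` to `M'` fixing the plane of `e₁, e₂`**: a quarter turn about `e₃`
times (a rotation about `e₁` times the segment to `U`). [folklore] -/
def conePrimePath (hn : coneNormal M u ≠ 0) (hM : 0 < M.det) : SmoothMatrixPath (conePrime M u) :=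
  ((rotZPath (π / 2)).mul ((rotXPath (coneAngle M u)).mul
    (upperSegPath (coneU M u) (coneU_entries hn hM).2.1 (coneU_entries hn hM).2.2.1
      (coneU_entries hn hM).2.2.2.1 (by rw [(coneU_entries hn hM).1]; exact one_pos)
      (by rw [(coneU_entries hn hM).2.2.2.2.1]; exact norm_coneZ_pos hn hM)
      (by rw [(coneU_entries hn hM).2.2.2.2.2]; exact div_pos hM (norm_coneZ_pos hn hM))))).cast
    rotZ_mul_rotX_mul_coneU

/-- The path to `M'` moves `e₁` by the quarter turn only: `e₁ ↦ cos(π σ/2) e₁ + sin(π σ/2) e₂`. [folklore] -/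
theorem conePrimePath_mulVec_single_zero (hn : coneNormal M u ≠ 0) (hM : 0 < M.det) (θ : ℝ) :
    (conePrimePath hn hM).toFun θ *ᵥ Pi.single 0 1 =
      Real.cos (π / 2 * ς θ) • Pi.single 0 1 + Real.sin (π / 2 * ς θ) • Pi.single 1 1 := by
  rw [conePrimePath, SmoothMatrixPath.cast_toFun]
  change ((rotZPath (π / 2)).toFun θ * ((rotXPath (coneAngle M u)).toFun θ *
    (upperSegPath (coneU M u) _ _ _ _ _ _).toFun θ)) *ᵥ Pi.single 0 1 = _
  rw [← Matrix.mulVec_mulVec, ← Matrix.mulVec_mulVec,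
    upperSegPath_mulVec_single_zero _ _ _ _ _ _ _ (coneU_entries hn hM).1, rotXPath_toFun,
    rotX_mulVec_single_zero, rotZPath_toFun, rotZ_mulVec_single_zero]

variable (M u)

/-- **The cone-nice path from `1` to `M`**: the path to `M'` conjugated back by the adapted basis
`P = (u | M u | u × M u)`. It needs `u × M u ≠ 0` and `det M > 0`. [cite: GompfAGT2010, §4 ¶3 (each straightening keeps φ(α) within T)] -/
def conePath (hn : coneNormal M u ≠ 0) (hM : 0 < M.det) : SmoothMatrixPath M :=
  (SmoothMatrixPath.conjGL (coneBasis M u) (det_coneBasis_ne_zero hn) (conePrimePath hn hM)).cast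
    (coneBasis_mul_conePrime_mul_inv hn)

/-- **The full turn about the axis `u`**, `θ ↦ P R_x(2π ς θ) P⁻¹`, a smooth loop at `1` fixing `u`. [cite: HatcherAT2002, §3.D (π₁(SO(3)) = ℤ₂, generated by a full rotation)] -/
def coneLoop (hn : coneNormal M u ≠ 0) : SmoothMatrixPath (1 : Matrix (Fin 3) (Fin 3) ℝ) :=
  (SmoothMatrixPath.conjGL (coneBasis M u) (det_coneBasis_ne_zero hn) rotXLoop).cast
    (by rw [Matrix.mul_one, coneBasis_mul_inv hn])

/-- **The cone-nice path of the other straightening class**: the full turn about `u` followed by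
`conePath M u`. [cite: GompfAGT2010, §4 ¶3 ("The isotopies will differ by a full twist in the normal bundle of the curve")] -/
def coneLoopPath (hn : coneNormal M u ≠ 0) (hM : 0 < M.det) : SmoothMatrixPath M :=
  ((coneLoop M u hn).concat (conePath M u hn hM)).cast (Matrix.mul_one M)

variable {M u}

/-- **Values of the cone path on `u`**: `γ(θ) u = cos(π ς(θ)/2) u + sin(π ς(θ)/2) M u`. [folklore] -/
theorem conePath_mulVec (hn : coneNormal M u ≠ 0) (hM : 0 < M.det) (θ : ℝ) :
    (conePath M u hn hM).toFun θ *ᵥ u =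
      Real.cos (π / 2 * ς θ) • u + Real.sin (π / 2 * ς θ) • M *ᵥ u := by
  rw [conePath, SmoothMatrixPath.cast_toFun, SmoothMatrixPath.conjGL_toFun, ← Matrix.mulVec_mulVec,
    ← Matrix.mulVec_mulVec, coneBasis_inv_mulVec hn, conePrimePath_mulVec_single_zero,
    Matrix.mulVec_add, Matrix.mulVec_smul, Matrix.mulVec_smul, coneBasis_mulVec_single_zero,
    coneBasis_mulVec_single_one]

/-- The full turn about `u` fixes `u`. [folklore] -/
theorem coneLoop_mulVec (hn : coneNormal M u ≠ 0) (θ : ℝ) : (coneLoop M u hn).toFun θ *ᵥ u = u := by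
  rw [coneLoop, SmoothMatrixPath.cast_toFun, SmoothMatrixPath.conjGL_toFun, ← Matrix.mulVec_mulVec,
    ← Matrix.mulVec_mulVec, coneBasis_inv_mulVec hn, rotXLoop_toFun, rotX_mulVec_single_zero,
    coneBasis_mulVec_single_zero]

/-- **Values of the looped cone path on `u`**: the loop is invisible, then `conePath` at double
speed. [folklore] -/
theorem coneLoopPath_mulVec (hn : coneNormal M u ≠ 0) (hM : 0 < M.det) (θ : ℝ) :
    (coneLoopPath M u hn hM).toFun θ *ᵥ u =
      Real.cos (π / 2 * ς (2 * θ - 1)) • u + Real.sin (π / 2 * ς (2 * θ - 1)) • M *ᵥ u := by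
  rw [coneLoopPath, SmoothMatrixPath.cast_toFun]
  change ((conePath M u hn hM).toFun (2 * θ - 1) * (coneLoop M u hn).toFun (2 * θ)) *ᵥ u = _
  rw [← Matrix.mulVec_mulVec, coneLoop_mulVec hn, conePath_mulVec hn hM]

/-- The coefficient functions `cos(π σ/2)`, `sin(π σ/2)` (precomposed with an affine map) have the
properties required by `IsConeNice`. [folklore] -/
theorem isConeNice_of_eq {γ : SmoothMatrixPath M} {c d : ℝ} (hc : 0 < c) (hcd0 : d ≤ 0)
    (hcd1 : 1 ≤ c + d)
    (h : ∀ θ, γ.toFun θ *ᵥ u = Real.cos (π / 2 * ς (c * θ + d)) • u +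
      Real.sin (π / 2 * ς (c * θ + d)) • M *ᵥ u) : γ.IsConeNice u := by
  have hσI : ∀ x : ℝ, π / 2 * ς x ∈ Icc 0 (π / 2) := fun x ↦
    ⟨mul_nonneg (by positivity) (Real.smoothTransition.nonneg x),
      by nlinarith [Real.smoothTransition.le_one x, Real.pi_pos]⟩
  have hcos0 : ∀ x : ℝ, 0 ≤ Real.cos (π / 2 * ς x) := fun x ↦
    Real.cos_nonneg_of_mem_Icc ⟨by linarith [(hσI x).1, Real.pi_pos], (hσI x).2⟩
  have hsin0 : ∀ x : ℝ, 0 ≤ Real.sin (π / 2 * ς x) := fun x ↦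
    Real.sin_nonneg_of_nonneg_of_le_pi (hσI x).1 (by linarith [(hσI x).2, Real.pi_pos])
  -- `cos (π ς x / 2) = 0 ↔ 1 ≤ x` and `sin (π ς x / 2) = 0 ↔ x ≤ 0`
  have hcos_eq : ∀ x : ℝ, Real.cos (π / 2 * ς x) = 0 ↔ 1 ≤ x := fun x ↦ by
    constructor
    · intro hx
      by_contra hlt
      have h1 : ς x < 1 := Real.smoothTransition.lt_one_of_lt_one (not_le.1 hlt)
      have : 0 < Real.cos (π / 2 * ς x) := Real.cos_pos_of_mem_Ioo
        ⟨by linarith [(hσI x).1, Real.pi_pos], by nlinarith [Real.pi_pos]⟩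
      linarith
    · intro hx
      rw [Real.smoothTransition.one_of_one_le hx, mul_one, Real.cos_pi_div_two]
  have hsin_eq : ∀ x : ℝ, Real.sin (π / 2 * ς x) = 0 ↔ x ≤ 0 := fun x ↦ by
    constructor
    · intro hx
      by_contra hlt
      have h1 : 0 < ς x := Real.smoothTransition.pos_of_pos (not_le.1 hlt)
      have : 0 < Real.sin (π / 2 * ς x) :=
        Real.sin_pos_of_pos_of_lt_pi (mul_pos (by positivity) h1)
          (by linarith [(hσI x).2, Real.pi_pos])
      linarith
    · intro hx
      rw [Real.smoothTransition.zero_of_nonpos hx, mul_zero, Real.sin_zero]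
  refine ⟨fun θ ↦ Real.cos (π / 2 * ς (c * θ + d)), fun θ ↦ Real.sin (π / 2 * ς (c * θ + d)),
    by fun_prop, by fun_prop, fun θ ↦ hcos0 _, fun θ ↦ hsin0 _, fun θ hθ ↦ ?_, fun θ hθ ↦ ?_,
    fun θ θ' hθθ' hθ ↦ ?_, fun θ θ' hθθ' hθ' ↦ ?_, h⟩
  · have hx : c * θ + d ≤ 0 := by nlinarith
    simp only [Real.smoothTransition.zero_of_nonpos hx, mul_zero, Real.cos_zero, Real.sin_zero,
      and_self]
  · have hx : 1 ≤ c * θ + d := by nlinarith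
    simp only [Real.smoothTransition.one_of_one_le hx, mul_one, Real.cos_pi_div_two,
      Real.sin_pi_div_two, and_self]
  · rw [hcos_eq] at hθ ⊢
    nlinarith
  · rw [hsin_eq] at hθ' ⊢
    nlinarith

/-- **`conePath` is cone-nice.** [cite: GompfAGT2010, §4 ¶3 (each straightening keeps φ(α) within T)] -/
theorem isConeNice_conePath (hn : coneNormal M u ≠ 0) (hM : 0 < M.det) :
    (conePath M u hn hM).IsConeNice u :=
  isConeNice_of_eq (c := 1) (d := 0) one_pos le_rfl (by norm_num)
    fun θ ↦ by rw [conePath_mulVec hn hM]; simp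

/-- **`coneLoopPath` is cone-nice.** [cite: GompfAGT2010, §4 ¶3 (each straightening keeps φ(α) within T)] -/
theorem isConeNice_coneLoopPath (hn : coneNormal M u ≠ 0) (hM : 0 < M.det) :
    (coneLoopPath M u hn hM).IsConeNice u :=
  isConeNice_of_eq (c := 2) (d := -1) two_pos (by norm_num) (by norm_num)
    fun θ ↦ by rw [coneLoopPath_mulVec hn hM]; ring_nf

end Paths

/-! ### The full turn about `u` is essential; the two cone paths are not homotopic -/

section Essential

open Literature.AlgebraicTopology.FundamentalGroup.RotLoop (square_false bc bs bc_bs_of_bottom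
  bc_bs_of_not_bottom rotBlock_zero rotBlock_one_zero)

variable {M : Matrix (Fin 3) (Fin 3) ℝ} {u : Fin 3 → ℝ}

/-- The cyclic permutation matrix `S`: `S e₁ = e₂`, `S e₂ = e₃`, `S e₃ = e₁`. [folklore] -/
def cycPerm : Matrix (Fin 3) (Fin 3) ℝ := !![0, 0, 1; 1, 0, 0; 0, 1, 0]

/-- `S Sᵀ = 1`. [folklore] -/
theorem cycPerm_mul_transpose : cycPerm * cycPermᵀ = 1 := by
  ext i j; fin_cases i <;> fin_cases j <;> simp [cycPerm, Matrix.mul_apply, Fin.sum_univ_three]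

/-- **`S R_x Sᵀ = R_y`**: the rotation about the first axis, conjugated by the cyclic permutation,
is the tree's `rotY` (whose full turn is the essential loop of `RotationLoopEssential`). [folklore] -/
theorem cycPerm_mul_rotX_mul_transpose (c s : ℝ) : cycPerm * rotX c s * cycPermᵀ = rotY c s := by
  ext i j
  fin_cases i <;> fin_cases j <;> simp [cycPerm, rotX, rotY, Matrix.mul_apply, Fin.sum_univ_three]

/-- `det (P X P⁻¹) = det X`. [folklore] -/
theorem det_coneBasis_conj (hn : coneNormal M u ≠ 0) (X : Matrix (Fin 3) (Fin 3) ℝ) :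
    (coneBasis M u * X * (coneBasis M u)⁻¹).det = X.det := by
  rw [Matrix.det_mul, Matrix.det_mul, mul_comm (coneBasis M u).det, mul_assoc, ← Matrix.det_mul,
    coneBasis_mul_inv hn, Matrix.det_one, mul_one]

/-- `det (P⁻¹ X P) = det X`. [folklore] -/
theorem det_coneBasis_inv_conj (hn : coneNormal M u ≠ 0) (X : Matrix (Fin 3) (Fin 3) ℝ) :
    ((coneBasis M u)⁻¹ * X * coneBasis M u).det = X.det := by
  rw [Matrix.det_mul, Matrix.det_mul, mul_comm ((coneBasis M u)⁻¹).det, mul_assoc,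
    ← Matrix.det_mul, coneBasis_inv_mul hn, Matrix.det_one, mul_one]

/-- `P⁻¹ (P X P⁻¹) P = X`. [folklore] -/
theorem coneBasis_inv_conj_conj (hn : coneNormal M u ≠ 0) (X : Matrix (Fin 3) (Fin 3) ℝ) :
    (coneBasis M u)⁻¹ * (coneBasis M u * X * (coneBasis M u)⁻¹) * coneBasis M u = X := by
  calc (coneBasis M u)⁻¹ * (coneBasis M u * X * (coneBasis M u)⁻¹) * coneBasis M u
      = ((coneBasis M u)⁻¹ * coneBasis M u) * X * ((coneBasis M u)⁻¹ * coneBasis M u) := by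
        simp only [Matrix.mul_assoc]
    _ = X := by rw [coneBasis_inv_mul hn, Matrix.one_mul, Matrix.mul_one]

/-- **The full turn about `u` at uniform speed**, `x ↦ P R_x(2πx) P⁻¹`, as a loop at `1` in
`GL⁺(3, ℝ)`. [cite: HatcherAT2002, §3.D (π₁(SO(3)) = ℤ₂, generated by a full rotation)] -/
def coneTurn (hn : coneNormal M u ≠ 0) : Path (1 : PosDetMatrix 3) 1 where
  toFun x := ⟨coneBasis M u * rotX (Real.cos (2 * π * x)) (Real.sin (2 * π * x)) * (coneBasis M u)⁻¹,
    by rw [det_coneBasis_conj hn, det_rotX', Real.cos_sq_add_sin_sq]; exact one_pos⟩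
  continuous_toFun := by
    refine Continuous.subtype_mk ((continuous_const.mul ?_).mul continuous_const) _
    refine continuous_matrix fun i j ↦ ?_
    fin_cases i <;> fin_cases j <;> simp [rotX] <;> fun_prop
  source' := by
    apply Subtype.ext
    simp [rotX_one_zero', coneBasis_mul_inv hn]
  target' := by
    apply Subtype.ext
    simp [rotX_one_zero', coneBasis_mul_inv hn]

/-- **The full turn about `u` is not null-homotopic in `GL⁺(3, ℝ)`**: conjugating a null-homotopy
by `P` and the cyclic permutation would extend the tree's rotation loop `rotY` over the square
(`RotationLoopEssential.square_false`). [cite: HatcherAT2002, §3.D (π₁(SO(3)) = ℤ₂, generated by a full rotation)] -/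
theorem coneTurn_not_homotopic_refl (hn : coneNormal M u ≠ 0) :
    ¬ (coneTurn hn).Homotopic (Path.refl 1) := by
  rintro ⟨F⟩
  have hF : Continuous fun y : Fin 2 → I ↦ (F (y 1, y 0)).1 :=
    continuous_subtype_val.comp (F.continuous.comp (by fun_prop))
  refine square_false 0
    (G := fun y ↦ cycPerm * ((coneBasis M u)⁻¹ * (F (y 1, y 0)).1 * coneBasis M u) * cycPermᵀ)
    (((continuous_const.mul ((continuous_const.mul hF).mul continuous_const)).mul
      continuous_const)) (fun y ↦ ?_) ?_
  · rw [Matrix.det_mul, Matrix.det_mul, det_coneBasis_inv_conj hn, Matrix.det_transpose]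
    have hS : cycPerm.det = 1 := by simp [cycPerm, Matrix.det_fin_three]
    rw [hS, one_mul, mul_one]
    exact (F (y 1, y 0)).2.ne'
  · intro y hy
    by_cases h : y 1 = 0
    · obtain ⟨h1, h2⟩ := bc_bs_of_bottom h
      rw [h1, h2, h, rotBlock_zero]
      change cycPerm * ((coneBasis M u)⁻¹ * (F (0, y 0)).1 * coneBasis M u) * cycPermᵀ = _
      rw [F.apply_zero]
      change cycPerm * ((coneBasis M u)⁻¹ * (coneBasis M u * rotX _ _ * (coneBasis M u)⁻¹) *
        coneBasis M u) * cycPermᵀ = _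
      rw [coneBasis_inv_conj_conj hn, cycPerm_mul_rotX_mul_transpose]
    · obtain ⟨h1, h2⟩ := bc_bs_of_not_bottom hy h
      rw [h1, h2, rotBlock_one_zero]
      suffices hF1 : (F (y 1, y 0)).1 = 1 by
        change cycPerm * ((coneBasis M u)⁻¹ * (F (y 1, y 0)).1 * coneBasis M u) * cycPermᵀ = 1
        rw [hF1, Matrix.mul_one, coneBasis_inv_mul hn, Matrix.mul_one, cycPerm_mul_transpose]
      rcases Fin.exists_fin_two.1 hy with hi | hi
      · have hx : y 0 ∈ ({0, 1} : Set I) := by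
          rcases hi with h0 | h0
          · exact Or.inl h0
          · exact Or.inr h0
        rw [F.eq_fst (y 1) hx]
        rcases hi with h0 | h0
        · rw [h0]; show ((coneTurn hn) 0).1 = 1; rw [(coneTurn hn).source]; rfl
        · rw [h0]; show ((coneTurn hn) 1).1 = 1; rw [(coneTurn hn).target]; rfl
      · rcases hi with h1' | h1'
        · exact absurd h1' h
        · rw [h1', F.apply_one]; rfl

/-- The smooth full turn is the uniform one reparametrised by the smooth transition. [folklore] -/
theorem toPath_coneLoop (hn : coneNormal M u ≠ 0) :
    (coneLoop M u hn).toPath =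
      (coneTurn hn).reparam transitionI continuous_transitionI transitionI_zero transitionI_one := by
  refine Path.ext (funext fun x ↦ Subtype.ext ?_)
  rfl

/-- **The smooth full turn about `u` is essential.** [cite: HatcherAT2002, §3.D (π₁(SO(3)) = ℤ₂, generated by a full rotation)] -/
theorem coneLoop_not_homotopic_refl (hn : coneNormal M u ≠ 0) :
    ¬ (coneLoop M u hn).toPath.Homotopic (Path.refl 1) := fun h ↦
  coneTurn_not_homotopic_refl hn (Path.Homotopic.trans
    ⟨Path.Homotopy.reparam _ _ continuous_transitionI transitionI_zero transitionI_one⟩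
    (by rw [← toPath_coneLoop hn]; exact h))

/-- **Concatenation with a loop, as paths**: for a smooth loop `L` at `1` and a path `γ` to `M`,
the path of `L.concat γ` is `L.toPath.trans γ.toPath`. [folklore] -/
theorem SmoothMatrixPath.toPath_concat_loop (L : SmoothMatrixPath (1 : Matrix (Fin 3) (Fin 3) ℝ))
    (γ : SmoothMatrixPath M) :
    ((L.concat γ).cast (Matrix.mul_one M)).toPath = L.toPath.trans γ.toPath := by
  refine Path.ext (funext fun t ↦ Subtype.ext ?_)
  rw [Path.trans_apply]
  split_ifs with ht
  · exact L.concat_toFun_of_le_half γ ht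
  · change (L.concat γ).toFun t = γ.toFun (2 * t - 1)
    rw [L.concat_toFun_of_half_le γ (not_le.1 ht).le, Matrix.mul_one]

/-- Right cancellation in the fundamental groupoid. [folklore] -/
theorem quotient_trans_right_cancel {X : Type*} [TopologicalSpace X] {x y z : X}
    {p q : Path.Homotopic.Quotient x y} (r : Path.Homotopic.Quotient y z)
    (h : p.trans r = q.trans r) : p = q := by
  have h' := congrArg (fun s ↦ Path.Homotopic.Quotient.trans s r.symm) h
  simp only [Path.Homotopic.Quotient.trans_assoc, Path.Homotopic.Quotient.trans_symm,
    Path.Homotopic.Quotient.trans_refl] at h'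
  exact h'

/-- **The two cone paths represent different straightening classes.** [cite: GompfAGT2010, §4 (after Def. 4.1: exactly two straightenings, differing by an element of π₁(GL(V)) = ℤ/2)] -/
theorem coneLoopPath_not_homotopic (hn : coneNormal M u ≠ 0) (hM : 0 < M.det) :
    ¬ (coneLoopPath M u hn hM).toPath.Homotopic (conePath M u hn hM).toPath := by
  intro h
  apply coneLoop_not_homotopic_refl hn
  rw [coneLoopPath, SmoothMatrixPath.toPath_concat_loop] at h
  have h1 := Path.Homotopic.Quotient.eq.2 h
  rw [Path.Homotopic.Quotient.mk_trans] at h1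
  have h1' : (Path.Homotopic.Quotient.mk (coneLoop M u hn).toPath).trans
      (Path.Homotopic.Quotient.mk (conePath M u hn hM).toPath) =
      (Path.Homotopic.Quotient.refl _).trans
        (Path.Homotopic.Quotient.mk (conePath M u hn hM).toPath) := by
    rw [Path.Homotopic.Quotient.refl_trans]; exact h1
  have h2 := quotient_trans_right_cancel _ h1'
  rw [← Path.Homotopic.Quotient.mk_refl] at h2
  exact Path.Homotopic.Quotient.eq.1 h2

end Essential

/-! ### Every straightening class has a cone-nice representative -/

section Coverage

variable {M : Matrix (Fin 3) (Fin 3) ℝ} {u : Fin 3 → ℝ}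

/-- **Every framing path from `1` to `M` is homotopic rel end points to a cone-nice one** (for any
`u` with `u × M u ≠ 0`): the classes of `conePath M u` and `coneLoopPath M u` are distinct, and
`π₁(GL⁺(3, ℝ), 1)` has only two elements (`fundamentalGroup_posDetMatrix_three_holds`), so the
pigeonhole `quotient_eq_or_eq_of_card_eq_two` applies. This is the matrix-path content of
Gompf's "the isotopy corresponding to each straightening of `A` can be chosen to keep `φ(α)`
within the torus `T`" (§4 ¶3). [cite: GompfAGT2010, §4 ¶3 (each straightening keeps φ(α) within T)] -/
theorem SmoothMatrixPath.exists_isConeNice_homotopic (γ : SmoothMatrixPath M)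
    (hn : u ⨯₃ (M *ᵥ u) ≠ 0) :
    ∃ γ' : SmoothMatrixPath M, γ'.IsConeNice u ∧ γ.toPath.Homotopic γ'.toPath := by
  have hM : 0 < M.det := γ.det_pos_of
  have hne : Path.Homotopic.Quotient.mk (conePath M u hn hM).toPath ≠
      Path.Homotopic.Quotient.mk (coneLoopPath M u hn hM).toPath := fun h ↦
    coneLoopPath_not_homotopic hn hM (Path.Homotopic.Quotient.eq.1 h.symm)
  rcases quotient_eq_or_eq_of_card_eq_two fundamentalGroup_posDetMatrix_three_holds hne
    (Path.Homotopic.Quotient.mk γ.toPath) with h | h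
  · exact ⟨conePath M u hn hM, isConeNice_conePath hn hM, Path.Homotopic.Quotient.eq.1 h⟩
  · exact ⟨coneLoopPath M u hn hM, isConeNice_coneLoopPath hn hM, Path.Homotopic.Quotient.eq.1 h⟩

/-! ### The Cappell–Shaneson specialisations -/

/-- For `B` in Gompf's standard form (`B e₁ = e₃`), `e₃ × B e₃ = (-B₁₂, B₀₂, 0)`. [folklore] -/
theorem cross_e₃_slRealMatrix (B : Matrix.SpecialLinearGroup (Fin 3) ℤ) :
    (Pi.single 2 1 : Fin 3 → ℝ) ⨯₃ (slRealMatrix B *ᵥ Pi.single 2 1) =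
      ![-(slRealMatrix B 1 2), slRealMatrix B 0 2, 0] := by
  rw [Matrix.mulVec_single_one, cross_apply]
  ext i; fin_cases i <;> simp

/-- **For `B` in standard form, `e₃ × B e₃ ≠ 0`** (otherwise the last column of `B` would be a
multiple of `e₃ = B e₁`, contradicting `det B = 1`). [cite: GompfAGT2010, §3 (standard form)] -/
theorem cross_e₃_slRealMatrix_ne_zero (B : Matrix.SpecialLinearGroup (Fin 3) ℤ)
    (hB : IsGompfStandardForm B) :
    (Pi.single 2 1 : Fin 3 → ℝ) ⨯₃ (slRealMatrix B *ᵥ Pi.single 2 1) ≠ 0 := by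
  rw [cross_e₃_slRealMatrix]
  intro h
  have h1 : slRealMatrix B 1 2 = 0 := by simpa using congrFun h 0
  have h0 : slRealMatrix B 0 2 = 0 := by simpa using congrFun h 1
  obtain ⟨h00, h10, h20⟩ := hB
  have hdet := det_slRealMatrix B
  rw [Matrix.det_fin_three] at hdet
  have e00 : slRealMatrix B 0 0 = 0 := by simp [slRealMatrix, h00]
  have e10 : slRealMatrix B 1 0 = 0 := by simp [slRealMatrix, h10]
  rw [e00, e10, h0, h1] at hdet
  simp at hdet

/-- **Cone-nice representatives for `u = e₃`**: for `B` in Gompf's standard form every framing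
path from `1` to `B` is homotopic to one moving `e₃` inside the plane `span {e₃, B e₃}` (the
plane `B · span {e₁, e₃}`), sweeping the cone from `e₃` to `B e₃`. [cite: GompfAGT2010, §4 ¶3 (each straightening keeps φ(α) within T)] -/
theorem exists_isConeNice_e₃ (B : Matrix.SpecialLinearGroup (Fin 3) ℤ) (hB : IsGompfStandardForm B)
    (γ : SmoothMatrixPath (slRealMatrix B)) :
    ∃ γ' : SmoothMatrixPath (slRealMatrix B),
      γ'.IsConeNice (Pi.single 2 1) ∧ γ.toPath.Homotopic γ'.toPath :=
  γ.exists_isConeNice_homotopic (cross_e₃_slRealMatrix_ne_zero B hB)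

/-- **For `B` in standard form, `B⁻¹ e₁ × e₁ ≠ 0`** (`B (B⁻¹ e₁) = e₁` is not a multiple of
`B e₁ = e₃`). [cite: GompfAGT2010, §3 (standard form)] -/
theorem cross_inv_e₁_ne_zero (B : Matrix.SpecialLinearGroup (Fin 3) ℤ) (hB : IsGompfStandardForm B) :
    (slRealMatrix B⁻¹ *ᵥ Pi.single 0 1) ⨯₃
      (slRealMatrix B *ᵥ (slRealMatrix B⁻¹ *ᵥ Pi.single 0 1)) ≠ 0 := by
  rw [Matrix.mulVec_mulVec, slRealMatrix_mul_inv, Matrix.one_mulVec]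
  intro h
  -- `v × e₁ = 0` forces `v₁ = v₂ = 0`, so `v = v₀ e₁` and `e₁ = B v = v₀ B e₁ = v₀ e₃`
  set v := slRealMatrix B⁻¹ *ᵥ (Pi.single 0 1 : Fin 3 → ℝ) with hv
  have hc : v ⨯₃ (Pi.single 0 1 : Fin 3 → ℝ) = ![0, v 2, -v 1] := by
    rw [cross_apply]; ext i; fin_cases i <;> simp
  rw [hc] at h
  have h2 : v 2 = 0 := by simpa using congrFun h 1
  have h1 : v 1 = 0 := by simpa using congrFun h 2
  have hBv : slRealMatrix B *ᵥ v = Pi.single 0 1 := by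
    rw [hv, Matrix.mulVec_mulVec, slRealMatrix_mul_inv, Matrix.one_mulVec]
  have hrow : (slRealMatrix B *ᵥ v) 0 = slRealMatrix B 0 0 * v 0 := by
    simp [Matrix.mulVec, dotProduct, Fin.sum_univ_three, h1, h2]
  rw [hBv] at hrow
  obtain ⟨h00, -, -⟩ := hB
  have e00 : slRealMatrix B 0 0 = 0 := by simp [slRealMatrix, h00]
  rw [e00, zero_mul] at hrow
  simp at hrow

/-- **Cone-nice representatives for `u = B⁻¹ e₁`**: every framing path from `1` to `B` is
homotopic to one moving `B⁻¹ e₁` inside the plane `span {B⁻¹ e₁, e₁} = B⁻¹ · span {e₁, e₃}`. [cite: GompfAGT2010, §4 ¶3 (each straightening keeps φ(α) within T)] -/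
theorem exists_isConeNice_inv_e₁ (B : Matrix.SpecialLinearGroup (Fin 3) ℤ)
    (hB : IsGompfStandardForm B) (γ : SmoothMatrixPath (slRealMatrix B)) :
    ∃ γ' : SmoothMatrixPath (slRealMatrix B),
      γ'.IsConeNice (slRealMatrix B⁻¹ *ᵥ Pi.single 0 1) ∧ γ.toPath.Homotopic γ'.toPath :=
  γ.exists_isConeNice_homotopic (cross_inv_e₁_ne_zero B hB)

end Coverage

end Literature.Topology.FourManifolds
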